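/-
Copyright (c) 2026 the pub-hodgecm-mathlib formalisation cell (harness21).  Prover seat hodgecm-mathlib-K2E3-p25 (g2), HCML Track B «K2-LIT»,
h413 = `stmt-HodgeConjecture-24833`, road (11-3-split-nsc), leaf (nsc-S-A′), brick (E4b-1γ, part 2c = the cell MAP) of the weak cell lemma (dealer D105′).  2026-09-04.
-/
import Summits.HodgeConjecture.HodgeConjecture.Theorems.K2E3GL3BorelInducedJacquetQOpenCellIntegrand   -- ★ part 2b (and parts 1, 2a)
import Summits.HodgeConjecture.HodgeConjecture.Theorems.K2E3GL3WeakCellLemmaTransport              -- ★ `exists_eq_trivial_twist`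
import Literature.NumberTheory.Automorphic.ParabolicInductionProofs                                -- ★ `rootDeltaChar_eq_one_of_mem_unipotentRadicalP`
import HarnessLib

/-!
# K2_E3 road (h413), leaf (nsc-S-A′), brick E4b-1γ part 2c — the cell map `X_Z → Ind_{B₂}^{GL₂}(χ₂ δ^{1/2})`, `Ψ̃f(g) = ∫_{F²} f(w·n(v)·ι̂(g)) dv`

Cell `pub/hodgecm-mathlib` (D-0151), Track B, seat K2E3-p25 (g2).  `--supports stmt-HodgeConjecture-24833 --as helper`; THEOREMS ONLY (no `def`, no instance, no notation,
no `sorry`); never imports `Cruxes/…/Lines`.  COUNT-NEUTRAL.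

THE MATHEMATICS ([BernsteinZelevinsky1977, §5, Thm. 5.2 (open orbit)]; [Casselman1995, Prop. 6.3.1, §6.3]).  `X_Z ≤ Ind_B^{GL₃} σ′` the functions vanishing on `Z = {m = 0}`
(`σ′` one-dimensional, trivial on `U₃`), `ι̂ : GL₂ → GL₃` a homomorphism with `ι̂(g) = diag(g,1)`.  **`exists_openCellMap`**: there are a torus character `χ₂` and a LINEAR map
`Ψ̃ : X_Z → Ind_{B₂}^{GL₂}((𝟙·χ₂)∘levi · δ_{B₂}^{1/2})` (the ★ `parabolicIndGL F id (𝟙.twist χ₂)` carrier, K2E3-p03's letter type) with `Ψ̃f(g) = ∫_{F²} f(w·n(v)·ι̂(g)) d(μ⊗μ)`.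
The character: `χ₂(t) = χ_{σ′}(w·ι̂(diag t)·w⁻¹) · |det(diag t)| · δ_{B₂}(diag t)^{-1/2}` (`σ′ = 𝟙·χ_{σ′}`, ★ `exists_eq_trivial_twist`); the `B₂`-equivariance
`Ψ̃f(b g) = δ^{1/2}(b) χ₂(levi b) Ψ̃f(g)` is ★ part 2b's substitution (`|det b|`) with `f(w ι̂(b) n(v) ι̂(g)) = σ′(w ι̂(b) w⁻¹) f(w n(v) ι̂(g))` (★ part 2a: `w ι̂(B₂) w⁻¹ ⊆ B`,
`w ι̂(U₂) w⁻¹ ⊆ U₃`, `δ|_{U₂} = 1`); smoothness from `Stab(f)` pulled back along the continuous `ι̂`.  Everything else (U_P-invariance, `GL₂`-equivariance, kernel, descent to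
`J_Z`) follows from the VALUE FORMULA alone and is part 3.

HONEST LABEL: HC_CM is proved only modulo the 7 printed citations (2 remaining named inputs: hLiu418 = stmt-HodgeConjecture-24832, h413 = stmt-HodgeConjecture-24833) until rung 0
closes; count-neutral helper.

## References
* [BernsteinZelevinsky1977] I. N. Bernstein, A. V. Zelevinsky, *Induced representations of reductive p-adic groups I*, Ann. Sci. ÉNS 10 (1977), §5 (Thm. 5.2).
* [Casselman1995] W. Casselman, *Introduction to the theory of admissible representations of p-adic reductive groups* (draft 1995), Prop. 6.3.1.
-/

set_option autoImplicit false
set_option linter.dupNamespace false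

noncomputable section

open Function Representation ValuativeRel MeasureTheory
open scoped MatrixGroups NNReal
open Literature.NumberTheory.Automorphic Literature.NumberTheory.GaloisRepresentations.IsNonarchimedeanLocalField
open Summit.HodgeConjecture.HodgeConjecture.Cruxes.H413.K2E3GL3BorelInducedJacquetQOpenCellAlgebra
open Summit.HodgeConjecture.HodgeConjecture.Cruxes.H413.K2E3GL3BorelInducedJacquetQOpenCellIntegrand
open Summit.HodgeConjecture.HodgeConjecture.Cruxes.H413.K2E3GL3WeakCellLemmaTransport
open Summit.HodgeConjecture.HodgeConjecture.Cruxes.H413.K2E3GL3OuterAutomorphismInduction (mem_unipotentRadicalP_iff)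

namespace Summit.HodgeConjecture.HodgeConjecture.Cruxes.H413.K2E3GL3BorelInducedJacquetQOpenCellMap

variable {F : Type} [Field F] [ValuativeRel F] [TopologicalSpace F] [IsNonarchimedeanLocalField F] [MeasurableSpace F] [BorelSpace F]
  (μ : Measure F) [μ.IsAddHaarMeasure]
  (h02 : (0 : Fin 3) ≠ 2) (h12 : (1 : Fin 3) ≠ 2)
  (σ' : Representation ℂ ↥(standardParabolicGL F (id : Fin 3 → Fin 3)) ℂ)
  (hσ'U : ∀ (u : GL (Fin 3) F) (hu : u ∈ upperUnitriangular (Fin 3) F), σ' ⟨u, unipotentRadicalGL_le F (id : Fin 3 → Fin 3) hu⟩ = 1)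
  (D : GL (Fin 2) F →* GL (Fin 3) F)
  (hD : ∀ g : GL (Fin 2) F, ((D g : GL (Fin 3) F) : Matrix (Fin 3) (Fin 3) F) =
    !![(g : Matrix (Fin 2) (Fin 2) F) 0 0, (g : Matrix (Fin 2) (Fin 2) F) 0 1, 0;
       (g : Matrix (Fin 2) (Fin 2) F) 1 0, (g : Matrix (Fin 2) (Fin 2) F) 1 1, 0;
       0, 0, 1])
  (hDc : Continuous D)

omit [MeasurableSpace F] [BorelSpace F] in
/-- **`|·|_F` on units as a character `Fˣ → ℂˣ`** exists with the expected values (inline construction; `|x| ≠ 0` for a unit). [folklore] -/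
theorem exists_normAbsChar : ∃ ν : Fˣ →* ℂˣ, ∀ x : Fˣ, ((ν x : ℂˣ) : ℂ) = ((normAbs F (x : F) : ℝ) : ℂ) := by
  have hne : ∀ x : Fˣ, (((normAbs F (x : F) : ℝ≥0) : ℝ) : ℂ) ≠ 0 := fun x => by
    have h1 : normAbs F (x : F) * normAbs F ((x⁻¹ : Fˣ) : F) = 1 := by rw [← map_mul, Units.mul_inv, map_one]
    intro h0
    have h2 : (normAbs F (x : F) : ℝ≥0) = 0 := by exact_mod_cast h0
    rw [h2, zero_mul] at h1
    exact zero_ne_one h1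
  refine ⟨{ toFun := fun x => Units.mk0 _ (hne x), map_one' := Units.ext (by simp), map_mul' := fun x y => Units.ext ?_ }, fun x => rfl⟩
  simp only [Units.val_mul, map_mul, NNReal.coe_mul, Complex.ofReal_mul, Units.val_mk0]

include hD hσ'U hDc in
/-- **THE CELL MAP OF THE OPEN `(B, P_{(2,1)})`-CELL.**  There are a torus character `χ₂` and a linear map `Ψ̃` from the functions vanishing on `Z` to the principal series
`Ind_{B₂}^{GL₂}((𝟙·χ₂)∘levi·δ^{1/2})` (K2E3-p03's letter type) with the VALUE FORMULA `Ψ̃f(g) = ∫ f(w·n(v)·ι̂(g)) d(μ⊗μ)`.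
[cite: BernsteinZelevinsky1977, §5, Thm. 5.2] [cite: Casselman1995, Prop. 6.3.1] -/
theorem exists_openCellMap :
    ∃ (χ₂ : (Π a : Fin 2, GL {i : Fin 2 // (id : Fin 2 → Fin 2) i = a} F) →* ℂˣ)
      (Ψ : ↥(vanishingOn (standardParabolicGL F (id : Fin 3 → Fin 3)) σ'
          {g : GL (Fin 3) F | (g : Matrix (Fin 3) (Fin 3) F) 1 0 * (g : Matrix (Fin 3) (Fin 3) F) 2 1 - (g : Matrix (Fin 3) (Fin 3) F) 1 1 * (g : Matrix (Fin 3) (Fin 3) F) 2 0 = 0}) →ₗ[ℂ]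
        SmoothInd (standardParabolicGL F (id : Fin 2 → Fin 2))
          (Representation.twist (((Representation.trivial ℂ (Π a : Fin 2, GL {i : Fin 2 // (id : Fin 2 → Fin 2) i = a} F) ℂ).twist χ₂).comp
            (leviProjection F (id : Fin 2 → Fin 2))) (rootDeltaChar (standardParabolicGL F (id : Fin 2 → Fin 2))))),
      ∀ (f : ↥(vanishingOn (standardParabolicGL F (id : Fin 3 → Fin 3)) σ'
          {g : GL (Fin 3) F | (g : Matrix (Fin 3) (Fin 3) F) 1 0 * (g : Matrix (Fin 3) (Fin 3) F) 2 1 - (g : Matrix (Fin 3) (Fin 3) F) 1 1 * (g : Matrix (Fin 3) (Fin 3) F) 2 0 = 0}))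
        (g : GL (Fin 2) F),
        (Ψ f).toFun g = ∫ v : Fin 2 → F, (f : SmoothInd (standardParabolicGL F (id : Fin 3 → Fin 3)) σ').toFun
          (permGL (Equiv.swap (1 : Fin 3) 2 * Equiv.swap 0 1) * (transvectionUnit 0 2 h02 (v 0) * transvectionUnit 1 2 h12 (v 1)) * D g) ∂(Measure.pi fun _ : Fin 2 => μ) := by
  haveI : IsTopologicalRing F := inferInstance
  -- `σ′ = 𝟙 · χ_{σ′}`
  obtain ⟨χσ, hχσ⟩ := exists_eq_trivial_twist σ'
  have hσval : ∀ (x : ↥(standardParabolicGL F (id : Fin 3 → Fin 3))) (z : ℂ), σ' x z = ((χσ x : ℂˣ) : ℂ) * z := fun x z => by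
    rw [hχσ, Representation.twist_apply, Representation.trivial_apply, smul_eq_mul]
  have hχσU : ∀ (u : GL (Fin 3) F) (hu : u ∈ upperUnitriangular (Fin 3) F), ((χσ ⟨u, unipotentRadicalGL_le F (id : Fin 3 → Fin 3) hu⟩ : ℂˣ) : ℂ) = 1 := by
    intro u hu
    have := congrArg (fun φ : ℂ →ₗ[ℂ] ℂ => φ 1) (hσ'U u hu)
    simpa [hσval] using this
  -- `|·|` as a character
  obtain ⟨ν, hν⟩ := exists_normAbsChar (F := F)
  -- conjugation by `w` composed with `ι̂`, as a homomorphism `B₂ → B₃`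
  set w : GL (Fin 3) F := permGL (Equiv.swap (1 : Fin 3) 2 * Equiv.swap 0 1) with hw
  let cB : ↥(standardParabolicGL F (id : Fin 2 → Fin 2)) →* ↥(standardParabolicGL F (id : Fin 3 → Fin 3)) :=
    { toFun := fun b => ⟨w * D b * w⁻¹, conj_permGL_diag_mem_borel D hD b.2⟩
      map_one' := Subtype.ext (by simp [hw])
      map_mul' := fun b b' => Subtype.ext (by
        simp only [Subgroup.coe_mul, map_mul]
        rw [show w * (D (b : GL (Fin 2) F) * D (b' : GL (Fin 2) F)) * w⁻¹ = (w * D b * w⁻¹) * (w * D b' * w⁻¹) by group]) }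
  have hcB : ∀ b : ↥(standardParabolicGL F (id : Fin 2 → Fin 2)), ((cB b : ↥(standardParabolicGL F (id : Fin 3 → Fin 3))) : GL (Fin 3) F) = w * D b * w⁻¹ :=
    fun _ => rfl
  -- the torus character
  let χ₂ : (Π a : Fin 2, GL {i : Fin 2 // (id : Fin 2 → Fin 2) i = a} F) →* ℂˣ :=
    ((χσ.comp (cB.comp (leviEmbeddingP F (id : Fin 2 → Fin 2)))) *
      (ν.comp (Matrix.GeneralLinearGroup.det.comp (blockDiagonalGL F (id : Fin 2 → Fin 2))))) *
      ((rootDeltaChar (standardParabolicGL F (id : Fin 2 → Fin 2)))⁻¹.comp (leviEmbeddingP F (id : Fin 2 → Fin 2)))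
  have hχ₂ : ∀ t, ((χ₂ t : ℂˣ) : ℂ) = ((χσ (cB (leviEmbeddingP F (id : Fin 2 → Fin 2) t)) : ℂˣ) : ℂ) *
      ((normAbs F (((blockDiagonalGL F (id : Fin 2 → Fin 2) t : GL (Fin 2) F) : Matrix (Fin 2) (Fin 2) F).det) : ℝ) : ℂ) *
      (((rootDeltaChar (standardParabolicGL F (id : Fin 2 → Fin 2)) (leviEmbeddingP F (id : Fin 2 → Fin 2) t))⁻¹ : ℂˣ) : ℂ) := by
    intro t
    simp only [χ₂, MonoidHom.mul_apply, MonoidHom.comp_apply, MonoidHom.inv_apply, Units.val_mul, hν, Matrix.GeneralLinearGroup.val_det_apply]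
  -- THE SCALAR IDENTITY: `|det b| χσ(w ι̂b w⁻¹) = δ^{1/2}(b) χ₂(levi b)` for `b ∈ B₂`
  have hscal : ∀ b : ↥(standardParabolicGL F (id : Fin 2 → Fin 2)),
      ((normAbs F ((((b : GL (Fin 2) F)) : Matrix (Fin 2) (Fin 2) F).det) : ℝ) : ℂ) * ((χσ (cB b) : ℂˣ) : ℂ) =
        ((rootDeltaChar (standardParabolicGL F (id : Fin 2 → Fin 2)) b : ℂˣ) : ℂ) * ((χ₂ (leviProjection F (id : Fin 2 → Fin 2) b) : ℂˣ) : ℂ) := by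
    intro b
    -- `b = m · u`, `t = levi b`, `m = diag t`, `u ∈ U₂`
    set t := leviProjection F (id : Fin 2 → Fin 2) b with ht
    set m := leviEmbeddingP F (id : Fin 2 → Fin 2) t with hm
    set u := m⁻¹ * b with hudef
    have hu : u ∈ unipotentRadicalP F (id : Fin 2 → Fin 2) := by
      rw [MonoidHom.mem_ker, hudef, map_mul, map_inv, hm, leviProjection_leviEmbeddingP_apply, ← ht, inv_mul_cancel]
    have hbmu : b = m * u := by rw [hudef, mul_inv_cancel_left]
    have huU : ((u : ↥(standardParabolicGL F (id : Fin 2 → Fin 2))) : GL (Fin 2) F) ∈ upperUnitriangular (Fin 2) F := by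
      have := (mem_unipotentRadicalP_iff F (id : Fin 2 → Fin 2) u).1 hu
      rwa [upperUnitriangular]
    -- the three factors on `u`
    have hδu : rootDeltaChar (standardParabolicGL F (id : Fin 2 → Fin 2)) u = 1 := rootDeltaChar_eq_one_of_mem_unipotentRadicalP (F := F) (c := (id : Fin 2 → Fin 2)) hu
    have hχu : ((χσ (cB u) : ℂˣ) : ℂ) = 1 := by
      have hmem := conj_permGL_diag_mem_upperUnitriangular D hD huU
      have : cB u = ⟨w * D (u : GL (Fin 2) F) * w⁻¹, unipotentRadicalGL_le F (id : Fin 3 → Fin 3) hmem⟩ := Subtype.ext rfl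
      rw [this]; exact hχσU _ hmem
    have hνu : normAbs F ((((u : ↥(standardParabolicGL F (id : Fin 2 → Fin 2))) : GL (Fin 2) F) : Matrix (Fin 2) (Fin 2) F).det) = 1 := by
      obtain ⟨h1, h2⟩ := (mem_upperUnitriangular_iff _).1 huU
      have h10 := h1 (show (id : Fin 2 → Fin 2) 0 < id 1 by decide)
      rw [Matrix.det_fin_two, h10, h2 0, h2 1, mul_zero, sub_zero, mul_one, map_one]
    have hmcoe : ((m : ↥(standardParabolicGL F (id : Fin 2 → Fin 2))) : GL (Fin 2) F) = blockDiagonalGL F (id : Fin 2 → Fin 2) t := rfl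
    have hδm0 : ((rootDeltaChar (standardParabolicGL F (id : Fin 2 → Fin 2)) m : ℂˣ) : ℂ) ≠ 0 := Units.ne_zero _
    -- both sides equal `|det m| · χσ(w ι̂(m) w⁻¹)`
    have hδb : rootDeltaChar (standardParabolicGL F (id : Fin 2 → Fin 2)) b = rootDeltaChar (standardParabolicGL F (id : Fin 2 → Fin 2)) m := by
      rw [hbmu, map_mul, hδu, mul_one]
    have hχb : ((χσ (cB b) : ℂˣ) : ℂ) = ((χσ (cB m) : ℂˣ) : ℂ) := by
      rw [hbmu, map_mul, map_mul, Units.val_mul, hχu, mul_one]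
    have hνb : normAbs F ((((b : GL (Fin 2) F)) : Matrix (Fin 2) (Fin 2) F).det) =
        normAbs F (((blockDiagonalGL F (id : Fin 2 → Fin 2) t : GL (Fin 2) F) : Matrix (Fin 2) (Fin 2) F).det) := by
      rw [hbmu, Subgroup.coe_mul, Units.val_mul, Matrix.det_mul, map_mul, hνu, mul_one, hmcoe]
    rw [hδb, hχb, hνb, hχ₂ t, ← hm, Units.val_inv_eq_inv_val]
    field_simp
  -- THE MAP on the level of functions: `Φf(g) = ∫ f(w n(v) D g) dv`
  haveI : T2Space F := (isLocalField F).toT2Space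
  haveI : LocallyCompactSpace F := (isLocalField F).toLocallyCompactSpace
  haveI : SecondCountableTopology F := Literature.NumberTheory.Automorphic.secondCountableTopology_localField F
  -- notation-free abbreviations
  let Zset : Set (GL (Fin 3) F) :=
    {g : GL (Fin 3) F | (g : Matrix (Fin 3) (Fin 3) F) 1 0 * (g : Matrix (Fin 3) (Fin 3) F) 2 1 - (g : Matrix (Fin 3) (Fin 3) F) 1 1 * (g : Matrix (Fin 3) (Fin 3) F) 2 0 = 0}
  let ρ₂ : Representation ℂ ↥(standardParabolicGL F (id : Fin 2 → Fin 2)) ℂ :=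
    Representation.twist (((Representation.trivial ℂ (Π a : Fin 2, GL {i : Fin 2 // (id : Fin 2 → Fin 2) i = a} F) ℂ).twist χ₂).comp
      (leviProjection F (id : Fin 2 → Fin 2))) (rootDeltaChar (standardParabolicGL F (id : Fin 2 → Fin 2)))
  have hρ₂ : ∀ (b : ↥(standardParabolicGL F (id : Fin 2 → Fin 2))) (z : ℂ),
      ρ₂ b z = (((rootDeltaChar (standardParabolicGL F (id : Fin 2 → Fin 2)) b : ℂˣ) : ℂ) * ((χ₂ (leviProjection F (id : Fin 2 → Fin 2) b) : ℂˣ) : ℂ)) * z := by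
    intro b z
    simp only [ρ₂, Representation.twist_apply, MonoidHom.coe_comp, Function.comp_apply, Representation.trivial_apply, smul_eq_mul]
    ring
  -- the cell function of `f` at `g`
  let cell : SmoothInd (standardParabolicGL F (id : Fin 3 → Fin 3)) σ' → GL (Fin 2) F → ℂ := fun f g =>
    ∫ v : Fin 2 → F, f.toFun (w * (transvectionUnit 0 2 h02 (v 0) * transvectionUnit 1 2 h12 (v 1)) * D g) ∂(Measure.pi fun _ : Fin 2 => μ)
  -- `B₂`-equivariance of `cell f`
  have hcellB : ∀ (f : SmoothInd (standardParabolicGL F (id : Fin 3 → Fin 3)) σ') (b : ↥(standardParabolicGL F (id : Fin 2 → Fin 2))) (g : GL (Fin 2) F),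
      cell f ((b : GL (Fin 2) F) * g) = ρ₂ b (cell f g) := by
    intro f b g
    rw [hρ₂, ← hscal b]
    simp only [cell]
    have hpt : ∀ v : Fin 2 → F, w * (transvectionUnit 0 2 h02 (v 0) * transvectionUnit 1 2 h12 (v 1)) * D ((b : GL (Fin 2) F) * g) =
        w * (transvectionUnit 0 2 h02 (v 0) * transvectionUnit 1 2 h12 (v 1)) * D b * D g := fun v => by simp only [map_mul, mul_assoc]
    simp_rw [hpt]
    rw [integral_cellFn_diag_mul h02 h12 σ' D hD μ f (b : GL (Fin 2) F) (D g), mul_assoc]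
    congr 1
    rw [← integral_const_mul]
    refine integral_congr_ae (Filter.Eventually.of_forall fun v => ?_)
    -- `f(w D b n(v) D g) = σ′(w D b w⁻¹) f(w n(v) D g)`
    have hconj : w * D (b : GL (Fin 2) F) * (transvectionUnit 0 2 h02 (v 0) * transvectionUnit 1 2 h12 (v 1)) * D g =
        ((cB b : ↥(standardParabolicGL F (id : Fin 3 → Fin 3))) : GL (Fin 3) F) * (w * (transvectionUnit 0 2 h02 (v 0) * transvectionUnit 1 2 h12 (v 1)) * D g) := by
      rw [hcB]; group
    change f.toFun _ = _ * f.toFun _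
    rw [hconj, f.toFun_subgroup_mul, hσval]
  -- right invariance under `D⁻¹(Stab f)`
  have hcellK : ∀ (f : SmoothInd (standardParabolicGL F (id : Fin 3 → Fin 3)) σ') (k : GL (Fin 2) F),
      D k ∈ (smoothIndRep (standardParabolicGL F (id : Fin 3 → Fin 3)) σ').stabilizerSubgroup f → ∀ g, cell f (g * k) = cell f g := by
    intro f k hk g
    simp only [cell]
    refine integral_congr_ae (Filter.Eventually.of_forall fun v => ?_)
    have hfk := congrArg (fun φ : SmoothInd (standardParabolicGL F (id : Fin 3 → Fin 3)) σ' => φ.toFun (w * (transvectionUnit 0 2 h02 (v 0) * transvectionUnit 1 2 h12 (v 1)) * D g))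
      ((mem_stabilizerSubgroup _ _ _).1 hk)
    simp only [toFun_smoothIndRep_apply] at hfk
    change f.toFun _ = f.toFun _
    rw [map_mul, ← mul_assoc, hfk]
  -- the element of the induced representation attached to `f`
  let mk : ↥(vanishingOn (standardParabolicGL F (id : Fin 3 → Fin 3)) σ' Zset) →
      SmoothInd (standardParabolicGL F (id : Fin 2 → Fin 2)) ρ₂ := fun f => by
    refine (⟨⟨cell (f : SmoothInd (standardParabolicGL F (id : Fin 3 → Fin 3)) σ'), ?_⟩, ?_⟩ :
      ↥(smoothInd (standardParabolicGL F (id : Fin 2 → Fin 2)) ρ₂).toSubmodule)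
    · rw [mem_indFun_iff]
      intro b g
      exact hcellB _ b g
    · refine (indFun (standardParabolicGL F (id : Fin 2 → Fin 2)) ρ₂).isSmoothVector_of_le
        (K := ((smoothIndRep (standardParabolicGL F (id : Fin 3 → Fin 3)) σ').stabilizerSubgroup
          (f : SmoothInd (standardParabolicGL F (id : Fin 3 → Fin 3)) σ')).comap D)
        ((isSmooth_smoothInd (standardParabolicGL F (id : Fin 3 → Fin 3)) σ' _).preimage hDc) fun k hk => ?_
      rw [mem_stabilizerSubgroup]
      refine Subtype.ext (funext fun g => ?_)
      rw [indFun_apply_apply]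
      exact hcellK _ k (Subgroup.mem_comap.1 hk) g
  have hmk : ∀ (f : ↥(vanishingOn (standardParabolicGL F (id : Fin 3 → Fin 3)) σ' Zset)) (g : GL (Fin 2) F),
      (mk f).toFun g = cell (f : SmoothInd (standardParabolicGL F (id : Fin 3 → Fin 3)) σ') g := fun _ _ => rfl
  -- linearity (integrability of the cell integrands of functions vanishing on `Z`)
  refine ⟨χ₂, { toFun := mk, map_add' := fun f₁ f₂ => ?_, map_smul' := fun a f => ?_ }, fun f g => hmk f g⟩
  · refine SmoothInd.ext (funext fun g => ?_)
    rw [SmoothInd.toFun_add, Pi.add_apply, hmk, hmk, hmk]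
    simp only [cell, Submodule.coe_add, SmoothInd.toFun_add, Pi.add_apply]
    exact integral_add (integrable_cellFn h02 h12 σ' D hD μ f₁.2 g) (integrable_cellFn h02 h12 σ' D hD μ f₂.2 g)
  · refine SmoothInd.ext (funext fun g => ?_)
    rw [SmoothInd.toFun_smul, Pi.smul_apply, hmk, hmk, RingHom.id_apply]
    simp only [cell, Submodule.coe_smul, SmoothInd.toFun_smul, Pi.smul_apply]
    exact integral_smul a _

end Summit.HodgeConjecture.HodgeConjecture.Cruxes.H413.K2E3GL3BorelInducedJacquetQOpenCellMap

end
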